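import Mathlib
import Summits.Ventures.PercRepro2.SwOutArmAsym

/-!
# An instance of the asymmetric domination (blind cell PercRepro2, night-4 g30, 2026-08-28;
proofs/NIGHT4-G30.md §7)

`exK5` = the complete graph on `Fin 5` (`l = 0`, `h = 1`): every vertex other than `l, h` is joined
to `l`, so `swAll2_of_outEdges` gives the asymmetric domination for EVERY pair of up-sets — here
the two-mark pair `𝓤₁ = {S ∣ 2 ∈ S}`, `𝓤₂ = {S ∣ 3 ∈ S}` (`swAll2_exK5`: on
`{h ∉ H_l, 2 ∈ C_R(l), 3 ∉ C_B(l)}` the blue edge set of `h` dominates the red one) and the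
cardinality pair `𝓤₁ = {S ∣ 3 ≤ |S|}`, `𝓤₂ = {S ∣ 2 ≤ |S|}` (`swAll2_exK5_card`: the red cluster
of `l` has three vertices, the blue one is trivial).
-/

namespace Summit.Ventures.PercRepro2

namespace LocRows

open Hull

/-- The complete graph on five vertices. -/
def exK5 : Fin 10 → Sym2 (Fin 5)
  | 0 => s(0, 1) | 1 => s(0, 2) | 2 => s(0, 3) | 3 => s(0, 4) | 4 => s(1, 2) | 5 => s(1, 3)
  | 6 => s(1, 4) | 7 => s(2, 3) | 8 => s(2, 4) | 9 => s(3, 4)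

/-- Every vertex other than `0, 1` is joined to `0`. -/
theorem exK5_out : ∀ x : Fin 5, x ≠ 0 → x ≠ 1 → ∃ e, exK5 e = s(x, 0) := by decide

/-- A principal family is an up-set. -/
lemma isUpperSet_mem (v : Fin 5) : IsUpperSet {S : Set (Fin 5) | v ∈ S} :=
  fun _ _ hST hv => hST hv

/-- A cardinality family is an up-set. -/
lemma isUpperSet_card (k : ℕ) : IsUpperSet {S : Set (Fin 5) | k ≤ S.ncard} :=
  fun _ _ hST hk => hk.trans (Set.ncard_le_ncard hST)

/-- **The two-mark domination on `K₅`**: `𝓤₁ = {S ∣ 2 ∈ S}`, `𝓤₂ = {S ∣ 3 ∈ S}`. -/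
theorem swAll2_exK5 : SwAll2 exK5 0 1 {S : Set (Fin 5) | 2 ∈ S} {S : Set (Fin 5) | 3 ∈ S} :=
  swAll2_of_outEdges (by decide) (by decide) (isUpperSet_mem 2) (isUpperSet_mem 3)
    fun x hx0 hx1 => Or.inr (Or.inl (exK5_out x hx0 hx1))

/-- **A cardinality pair on `K₅`**: `|C_R(l)| ≥ 3` against `|C_B(l)| ≥ 2`. -/
theorem swAll2_exK5_card :
    SwAll2 exK5 0 1 {S : Set (Fin 5) | 3 ≤ S.ncard} {S : Set (Fin 5) | 2 ≤ S.ncard} :=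
  swAll2_of_outEdges (by decide) (by decide) (isUpperSet_card 3) (isUpperSet_card 2)
    fun x hx0 hx1 => Or.inr (Or.inl (exK5_out x hx0 hx1))

/-- At one principal up-set the instance is row 2′SW-ALL on `K₅` with the mark `2`. -/
theorem swAll_exK5 : SwAll exK5 0 1 2 :=
  swAll_of_swAll2 (swAll2_of_outEdges (by decide) (by decide) (isUpperSet_mem 2) (isUpperSet_mem 2)
    fun x hx0 hx1 => Or.inr (Or.inl (exK5_out x hx0 hx1)))

end LocRows

end Summit.Ventures.PercRepro2
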